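import Summits.QuantumFields.YangMills.Theses.SqueezedSkewness
import HarnessLib

/-!
# Route `SqueezedSkewness`, glue `ChordFloorsGlue` (stmt-QuantumFields-23548, LINE χ «chord escalator») — BY NAME

`FemtoFloorUnit → TorusKL → ChordEscalator → FemtoCeiling → PointlikeHypercubeFloors`: the kernel-checked composition
`PointlikeHypercubeFloors_of` of the registered skeleton `Cruxes/NT/Lines/pointlike_node_birth.lean` (planner ym-idea-6 g12),
restated against the route decls so that the item closes by name.  In the floor unit `(r, a)` of `FemtoFloorUnit` and for each
radius `ρ`: the femto ceiling `C` of the unit (`FemtoCeiling`, from `FBL6`), the chord escalator of the hypercube (`ChordEscalator`,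
from `TorusKL`) at `s = a(β) ≤ min(h₁, 1)`, `h_c = h₁`, floor `min ε 1`, ceiling `max C 1`, give the unit-height floor
`(min ε 1)^A / (max C 1)^A`, `A = ⌈2δ₁/h₁⌉`, for `β ≥ max(β₅, β₆, β₇, 0)`, `a(β)L ≥ max(Λ₅, Λ₆, ρ + |δ₂| + 1)`.

Fleet lead `ym-spine-19353-p1` g19 (port; `FemtoCeiling` itself is this seat's `…SqueezedSkewnessFemtoCeiling`).  HONEST FRAMING:
pure composition; `FemtoFloorUnit` (XL), `TorusKL`, `ChordEscalator` are hypotheses here; no crux, NT statement, rung or mass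
gap follows. [folklore]
-/

set_option autoImplicit false

namespace Summit.QuantumFields.YangMills.Theorems.SqueezedSkewnessChordFloorsGlue

open Summit.QuantumFields.YangMills.Theses.SqueezedSkewness

/-- **`ChordFloorsGlue`** (item stmt-QuantumFields-23548), BY NAME. [folklore] -/
theorem chordFloorsGlue_proof : Summit.QuantumFields.YangMills.Theses.SqueezedSkewness.ChordFloorsGlue := by
  intro h1 h3 h4 h5 G i1 i2 i3 i4 hG
  letI : MeasurableSpace G := borel G
  haveI : BorelSpace G := ⟨rfl⟩
  obtain ⟨r, a, h1'⟩ := h1 G hG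
  refine ⟨r, a, ?_⟩
  dsimp only at h1' ⊢
  obtain ⟨ha, ha0, hF6, hall⟩ := h1'
  refine ⟨ha, ha0, fun ρ hρ => ?_⟩
  obtain ⟨v, hv0, hball, δ₁, δ₂, h₁, ε, β₅, Λ₅, hδ₁, hslab, hh₁, h3h₁, hε, hfloor⟩ := hall ρ hρ
  -- the femto ceiling of the unit (from `FBL6`)
  have h5' := h5 G hG r a ha ha0 hF6
  dsimp only at h5'
  obtain ⟨C, β₆, Λ₆, hceil⟩ := h5' v ρ δ₁ δ₂ h₁ hh₁ hball hslab
  -- the chord escalator of the hypercube (from `TorusKL`)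
  have h4' := h4 h3 G hG r
  dsimp only at h4'
  -- thresholds: `a β < min h₁ 1` eventually
  obtain ⟨β₇, hβ₇⟩ : ∃ β₇ : ℝ, ∀ β, β₇ ≤ β → a β < min h₁ 1 := by
    have h1 : ∀ᶠ β in Filter.atTop, a β < min h₁ 1 :=
      ha0.eventually (gt_mem_nhds (lt_min hh₁ one_pos))
    exact Filter.eventually_atTop.mp h1
  refine ⟨v, hv0, hball, δ₁, δ₂, (min ε 1) ^ ⌈2 * δ₁ / h₁⌉₊ / (max C 1) ^ ⌈2 * δ₁ / h₁⌉₊,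
    max β₅ (max β₆ (max β₇ 0)), max Λ₅ (max Λ₆ (ρ + |δ₂| + 1)), hδ₁, hslab, by positivity, ?_⟩
  intro β hβ L hL
  simp only [max_le_iff] at hβ hL
  obtain ⟨hβ5, hβ6, hβ7, hβ0⟩ := hβ
  obtain ⟨hΛ5, hΛ6, hΛρ⟩ := hL
  have hs : 0 < a β := ha β
  have hsh : a β ≤ h₁ := (hβ₇ β hβ7).le.trans (min_le_left _ _)
  have hs1 : a β ≤ 1 := (hβ₇ β hβ7).le.trans (min_le_right _ _)
  have hL1 : 1 ≤ L := by
    have h1 : (1 : ℝ) ≤ a β * L := by linarith [abs_nonneg δ₂, hρ.le]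
    have h2 : (1 : ℝ) ≤ (L : ℝ) := h1.trans (mul_le_of_le_one_left (Nat.cast_nonneg L) hs1)
    exact_mod_cast h2
  have hwin : ρ + δ₂ + 1 ≤ a β * L := by linarith [le_abs_self δ₂]
  exact h4' β L (a β) v ρ δ₁ δ₂ h₁ h₁ (min ε 1) (max C 1) hβ0 hL1 hs hsh le_rfl h3h₁ hs1 hwin hball hslab
    (lt_min hε one_pos) (min_le_right _ _) (le_max_right _ _)
    (fun k f hk1 hk2 hf => (min_le_left _ _).trans (hfloor β hβ5 L hΛ5 (a β * k) f hk1 hk2 hf))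
    (fun k g hk hg => (hceil β hβ6 L hΛ6 k g hk hg).trans (le_max_left _ _))

end Summit.QuantumFields.YangMills.Theorems.SqueezedSkewnessChordFloorsGlue
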